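import Literature.NumberTheory.Automorphic.RankinSelbergTorusPairEuler
import Literature.NumberTheory.Automorphic.RankinSelbergUnfoldedEulerCuspidal
import Literature.NumberTheory.Automorphic.RankinSelbergUnfoldingPairs
import Literature.NumberTheory.Automorphic.SatakeParameterBoundHolds
import HarnessLib

/-!
# `Ψ(s; W_φ, W̄_{φ'}, Φ) = L^{S'}(s, π × \bar{π'}) · Ψ_{S'}(s)` for the Whittaker coefficients of a PAIR
of cusp forms

Topic `NumberTheory/Automorphic`; namespace `Literature.NumberTheory.Automorphic`. Proof file (theorems
only: no definition, no named fact, no instance). The pair version of `RankinSelbergUnfoldedEulerCuspidal`: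
the abstract Euler factorisation of the unfolded Rankin–Selberg integral of a pair at a complex point
(`rankinSelbergTorusPairIntegralC_eq_mul_setIntegral_of_hasProd`, `RankinSelbergTorusPairEuler`) is
instantiated for the datum of the printed proof (Jacquet–Shalika (1981), §4–§5; Cogdell (2004), §2.3,
Thm. 2.2 with §3, Thm. 3.3): `W = W_φ`, `W' = \overline{W_{φ'}}` the global Whittaker coefficient of
`φ = invQuot (S_η f)`, `f ∈ π`, and the conjugate of that of `φ' = invQuot (S_η f')`, `f' ∈ π'`, two
cuspidal automorphic representations of `GL_n(𝔸_K)` with Satake families `α`, `γ` off `S`, and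
`Φ = Φ_∞ ⊗ 𝟙_{𝒪̂ⁿ}` a standard test function. The hypotheses of the abstract theorem are discharged
by the tree exactly as in the one-form file, with three additions: the two Whittaker functions are
given a **common uniformizer** at each good place (`IsTorusUnramifiedAt.of_valued_eq`), the conjugate
`\overline{W_{φ'}}` is an unramified datum with the conjugate parameters
(`IsTorusUnramifiedAt.star`; these enumerate the Satake family `γ̄` of `\bar{π'}`,
`IsSatakeFamilyOf.conj`), and the finiteness of the real torus sums `T_v(q_v^{-re s})` is taken from
the proved Satake bound `|α_{j,v}| ≤ q_v^{1/2}` (`norm_satakeParameter_le_sqrt_holds`,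
`schurSelfSum_ne_top_of_norm_satakeParameter_le_sqrt`) instead of a positivity hypothesis.

* `rankinSelbergTorusIntegral_star` — `Ψ(σ; W̄, ·) = Ψ(σ; W, ·)` for the real (absolute) unfolded
  integral;
* `rankinSelbergTorusPairIntegral_eq_rankinSelbergTorusPairIntegralC` — the real-parameter pair
  integral of `RankinSelbergUnfoldingPairs` is the complex one of `RankinSelbergTorusPairEuler` at
  `s = σ`;
* `rankinSelbergTorusPairIntegralC_whittakerCoeff_eq_partialPairL_mul` (**main**) — for `re s > 1`,
  with the two real unfolded integrals `Ψ(re s; W_φ, W̄_φ, Φ)`, `Ψ(re s; W_{φ'}, W̄_{φ'}, Φ)` finite,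
  `Ψ(s; W_φ, W̄_{φ'}, Φ) = partialPairL S' α γ̄ s · ∫_{B({v ∉ S'}) × K} I_s` — the Euler factorisation
  of the unfolded global Rankin–Selberg integral of the pair into the partial `L`-function
  `L^{S'}(s, π × \bar{π'})` and its `S'`-part (Cogdell (2004), Thm. 2.2: "`I(s; φ, φ') = L^S(s, π × π')
  · (local integrals at `v ∈ S`)"; Jacquet–Shalika (1981), §4 and Thm. (5.3), proof). With
  `π' := σ̄` this is the factorisation through `L^{S'}(s, π × σ)` used for Mœglin–Waldspurger's
  Corollaire (i)(b) (`PairLFunctionMeromorphicContinuation`).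

## References

* H. Jacquet, J. A. Shalika, *On Euler products and the classification of automorphic
  representations I*, Amer. J. Math. 103 (1981), §2 Prop. (2.3), §4, Thm. (5.3) proof
  [JacquetShalikaAJM1981].
* J. W. Cogdell, *Analytic theory of L-functions for GL_n*, in *An Introduction to the Langlands
  Program* (2004), §2.3 Thm. 2.2, §3 Thm. 3.3 [CogdellAnalyticTheory2004].
-/

noncomputable section

open MeasureTheory Measure NumberField IsDedekindDomain Matrix Set Filter Finset Topology
open scoped MatrixGroups ENNReal NNReal ComplexConjugate Pointwise
open Literature.RingTheory.SymmetricFunctions.SymmPoly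
open Literature.NumberTheory.GaloisRepresentations (ideleGroup localUnits)

namespace Literature.NumberTheory.Automorphic

/-! ### Two bookkeeping identities -/

section Bookkeeping

variable {n : ℕ} {K : Type} [Field K] [NumberField K]
variable [MeasurableSpace (ideleGroup K)] [MeasurableSpace (AdelicGroupData.gl n K).Adelic]

/-- The real unfolded integral only sees `|W|²`: `Ψ(σ; W̄, ·) = Ψ(σ; W, ·)`. [folklore] -/
theorem rankinSelbergTorusIntegral_star (νA : Measure (Fin n → ideleGroup K))
    (νK : Measure ↥(maximalCompactAdelic n K)) (W : GL (Fin n) (AdeleRing (𝓞 K) K) → ℂ)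
    (Φ : (Fin n → AdeleRing (𝓞 K) K) → ℝ) (σ : ℝ) :
    rankinSelbergTorusIntegral n K νA νK (star W) Φ σ = rankinSelbergTorusIntegral n K νA νK W Φ σ := by
  unfold rankinSelbergTorusIntegral torusIntegrand
  simp only [Pi.star_apply, norm_star]

/-- The real-parameter pair integral `Ψ(σ; W, W', Φ)` of `RankinSelbergUnfoldingPairs` is the complex one of
`RankinSelbergTorusPairEuler` at `s = σ` (`torusPairIntegrandC_ofReal`). [folklore] -/
theorem rankinSelbergTorusPairIntegral_eq_rankinSelbergTorusPairIntegralC (νA : Measure (Fin n → ideleGroup K))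
    (νK : Measure ↥(maximalCompactAdelic n K)) (W W' : GL (Fin n) (AdeleRing (𝓞 K) K) → ℂ)
    (Φ : (Fin n → AdeleRing (𝓞 K) K) → ℝ) (σ : ℝ) :
    rankinSelbergTorusPairIntegral n K νA νK W W' Φ σ = rankinSelbergTorusPairIntegralC n K νA νK W W' Φ (σ : ℂ) := by
  unfold rankinSelbergTorusPairIntegral rankinSelbergTorusPairIntegralC
  refine integral_congr_ae (Eventually.of_forall fun p => ?_)
  rw [torusPairIntegrandC_ofReal]
  rfl

end Bookkeeping

/-! ### The Euler factorisation for the Whittaker coefficients of a pair of cusp forms -/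

section Cuspidal

open ValuativeRel

variable {n : ℕ} {K : Type} [Field K] [NumberField K]
  {μ : Measure (AdelicGroupData.gl n K).automorphicQuotient} [(AdelicGroupData.gl n K).IsAutomorphicMeasure μ]
variable [MeasurableSpace ↥(adelicUnipotent n K)] [BorelSpace ↥(adelicUnipotent n K)]
  [MeasurableConstSMul ↥(rationalUnipotent n K) ↥(adelicUnipotent n K)]
  {ν : Measure ↥(adelicUnipotent n K)} [IsFiniteMeasureOnCompacts ν]
  [SMulInvariantMeasure ↥(rationalUnipotent n K) ↥(adelicUnipotent n K) ν] [ν.IsMulRightInvariant]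
  {𝓕 : Set ↥(adelicUnipotent n K)} {ψ : AddChar (AdeleRing (𝓞 K) K) Circle}
variable [MeasurableSpace (ideleGroup K)] [BorelSpace (ideleGroup K)]

-- the house local instances of `RankinSelbergUnfoldedEulerCuspidal` (Borel structures of `GL_n(𝔸_K)` in
-- both spellings, second countability of `𝔸_Kˣ`); none overrides a Mathlib instance
attribute [local instance] adelicBorel borelSpace_adelic locallyCompactSpace_adelic
  secondCountableTopology_gl_adelic secondCountableTopology_ideleGroup glAdeleBorel borelSpace_glAdele

/-- **`Ψ(s; W_φ, W̄_{φ'}, Φ) = L^{S'}(s, α ⊗ γ̄) · Ψ_{S'}(s)` on `re s > 1`.** Let `π`, `π'` be cuspidal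
automorphic representations of `GL_n(𝔸_K)` (`0 < n`) with Satake families `α`, `γ` off `S`, `f ∈ π`,
`f' ∈ π'`, `η` a continuous compactly supported left `K(𝔫₀)`-invariant weight, `φ = invQuot (S_η f)`,
`φ' = invQuot (S_η f')`, `W = W_φ`, `W' = W_{φ'}` their global Whittaker coefficients (fundamental domain
`𝓕` of `N_n(K) \ N_n(𝔸)` with compact closure, global character `ψ`), `Φ = Φ_∞ ⊗ 𝟙_{𝒪̂ⁿ}` with
`Φ_∞ ≥ 0` and `g ↦ Φ(e_n g)` measurable, and `S' ⊇ S` a set of finite places off which `v ∤ 𝔫₀` and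
`ψ_v` has conductor `𝒪_v`. For `re s > 1`, if the two real unfolded integrals `Ψ(re s; W, W̄, Φ)`,
`Ψ(re s; W', W̄', Φ)` are finite, then

  `Ψ(s; W, W̄', Φ) = partialPairL S' α γ̄ s · ∫_{B({v ∉ S'}) × K} W W̄' (diag(a) k) Φ(e_n diag(a) k) |det a|^s δ_B(a)⁻¹`

— the Euler factorisation of the unfolded global Rankin–Selberg integral of the pair `(φ, φ̄')` into the
partial `L`-function of `π × \bar{π'}` (`γ̄` is the Satake family of `\bar{π'}`, `IsSatakeFamilyOf.conj`)
and its `S'`-part (Cogdell (2004), Thm. 2.2 with Thm. 3.3; Jacquet–Shalika (1981), §4 and Thm. (5.3),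
proof). The two Whittaker functions are given a common uniformizer at each good place
(`IsTorusUnramifiedAt.of_valued_eq`), the real torus sums are finite by the Satake bound
(`norm_satakeParameter_le_sqrt_holds`), and the local factors `P_{α_v, γ̄_v}(q_v^{-s})⁻¹` multiply to
`partialPairL S' α γ̄ s` for `re s > 1` (`hasProd_partialPairL`,
`JacquetShalika1981_multipliable_partialPairL_holds`).
[cite: CogdellAnalyticTheory2004, §2.3 Thm. 2.2, §3 Thm. 3.3] [cite: JacquetShalikaAJM1981, §2 Prop. (2.3), §4] -/
theorem rankinSelbergTorusPairIntegralC_whittakerCoeff_eq_partialPairL_mul (hn : 0 < n)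
    (P Q : CuspidalAutomorphicRepGL n K μ) {S : Set (HeightOneSpectrum (𝓞 K))} {α γ : SatakeFamily K}
    (hα : IsSatakeFamilyOf P S α) (hγ : IsSatakeFamilyOf Q S γ) {𝔫₀ : Ideal (𝓞 K)} (h𝔫₀ : 𝔫₀ ≠ 0)
    {η : (AdelicGroupData.gl n K).Adelic → ℝ} (hη : Continuous η) (hηs : HasCompactSupport η)
    (hηK : ∀ k : (AdelicGroupData.gl n K).Adelic, k ∈ principalCongruenceLevel n K 𝔫₀ →
      ∀ g : (AdelicGroupData.gl n K).Adelic, η (k * g) = η g)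
    (f : P.1.toSubmodule) (f' : Q.1.toSubmodule)
    (h𝓕 : IsFundamentalDomain ↥(rationalUnipotent n K) 𝓕 ν) (h𝓕m : MeasurableSet 𝓕)
    (h𝓕c : IsCompact (closure 𝓕)) (hψ : IsGlobalAddChar K ψ)
    {S' : Set (HeightOneSpectrum (𝓞 K))} (hSS' : S ⊆ S')
    (hGood : ∀ v ∉ S', ¬ v.asIdeal ∣ 𝔫₀ ∧ (∀ c ∈ 𝒪[v.adicCompletion K], ψ.adicComponent v c = 1) ∧
      ∀ ϖ : v.adicCompletion K, Valued.v ϖ = WithZero.exp (-1 : ℤ) →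
        ∃ c ∈ 𝒪[v.adicCompletion K], ψ.adicComponent v (ϖ⁻¹ * c) ≠ 1)
    {x y : HeightOneSpectrum (𝓞 K) → Fin n → ℂ}
    (hx : ∀ v ∉ S', (Finset.univ : Finset (Fin n)).val.map (x v) = α v)
    (hy : ∀ v ∉ S', (Finset.univ : Finset (Fin n)).val.map (y v) = γ v)
    {Φinf : (Fin n → InfiniteAdeleRing K) → ℝ} (hΦinf : ∀ z, 0 ≤ Φinf z)
    (hΦm : Measurable fun g : GL (Fin n) (AdeleRing (𝓞 K) K) => standardTestFun n K Φinf (lastRow n K g))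
    (νA : Measure (Fin n → ideleGroup K)) [νA.IsMulLeftInvariant] [SFinite νA]
    (νK : Measure ↥(maximalCompactAdelic n K)) [SFinite νK] {s : ℂ} (hs : 1 < s.re)
    (hfin : rankinSelbergTorusIntegral n K νA νK
      (whittakerCoeff ν 𝓕 ψ
        (invQuot (AdelicGroupData.gl n K) (smoothedForm η (f : (AdelicGroupData.gl n K).L2 μ))))
      (standardTestFun n K Φinf) s.re ≠ ⊤)
    (hfin' : rankinSelbergTorusIntegral n K νA νK
      (whittakerCoeff ν 𝓕 ψ
        (invQuot (AdelicGroupData.gl n K) (smoothedForm η (f' : (AdelicGroupData.gl n K).L2 μ))))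
      (standardTestFun n K Φinf) s.re ≠ ⊤) :
    rankinSelbergTorusPairIntegralC n K νA νK
        (whittakerCoeff ν 𝓕 ψ
          (invQuot (AdelicGroupData.gl n K) (smoothedForm η (f : (AdelicGroupData.gl n K).L2 μ))))
        (star (whittakerCoeff ν 𝓕 ψ
          (invQuot (AdelicGroupData.gl n K) (smoothedForm η (f' : (AdelicGroupData.gl n K).L2 μ)))))
        (standardTestFun n K Φinf) s =
      partialPairL S' α (fun v => (γ v).map conj) s *
        ∫ p in unitBox {v | v ∉ S'} ×ˢ Set.univ, torusPairIntegrandC n K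
          (whittakerCoeff ν 𝓕 ψ
            (invQuot (AdelicGroupData.gl n K) (smoothedForm η (f : (AdelicGroupData.gl n K).L2 μ))))
          (star (whittakerCoeff ν 𝓕 ψ
            (invQuot (AdelicGroupData.gl n K) (smoothedForm η (f' : (AdelicGroupData.gl n K).L2 μ)))))
          (standardTestFun n K Φinf) s p ∂(νA.prod νK) := by
  classical
  set φ : GL (Fin n) (AdeleRing (𝓞 K) K) → ℂ :=
    invQuot (AdelicGroupData.gl n K) (smoothedForm η (f : (AdelicGroupData.gl n K).L2 μ)) with hφ
  set φ' : GL (Fin n) (AdeleRing (𝓞 K) K) → ℂ :=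
    invQuot (AdelicGroupData.gl n K) (smoothedForm η (f' : (AdelicGroupData.gl n K).L2 μ)) with hφ'
  set W : GL (Fin n) (AdeleRing (𝓞 K) K) → ℂ := whittakerCoeff ν 𝓕 ψ φ with hWdef
  set W' : GL (Fin n) (AdeleRing (𝓞 K) K) → ℂ := whittakerCoeff ν 𝓕 ψ φ' with hW'def
  set Φ : (Fin n → AdeleRing (𝓞 K) K) → ℝ := standardTestFun n K Φinf with hΦdef
  have hGood' : ∀ v ∈ {v : HeightOneSpectrum (𝓞 K) | v ∉ S'}, v ∉ S ∧ ¬ v.asIdeal ∣ 𝔫₀ ∧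
      (∀ c ∈ 𝒪[v.adicCompletion K], ψ.adicComponent v c = 1) ∧
      ∀ ϖ : v.adicCompletion K, Valued.v ϖ = WithZero.exp (-1 : ℤ) →
        ∃ c ∈ 𝒪[v.adicCompletion K], ψ.adicComponent v (ϖ⁻¹ * c) ≠ 1 :=
    fun v hv => ⟨fun h => hv (hSS' h), hGood v hv⟩
  -- the uniformizers of the Satake data of `π` at the good places, shared with `π'`
  have hex : ∀ v ∉ S', ∃ ϖ : (v.adicCompletion K)ˣ, IsTorusUnramifiedAt n K W v ϖ (x v) := fun v hv =>
    exists_isTorusUnramifiedAt_whittakerCoeff_smoothedForm P hα h𝔫₀ (hGood' v hv).1 (hGood v hv).1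
      hη hηs hηK f (hx v hv) h𝓕 h𝓕c hψ (hGood v hv).2.1 (hGood v hv).2.2
  have hex' : ∀ v ∉ S', ∃ ϖ : (v.adicCompletion K)ˣ, IsTorusUnramifiedAt n K W' v ϖ (y v) := fun v hv =>
    exists_isTorusUnramifiedAt_whittakerCoeff_smoothedForm Q hγ h𝔫₀ (hGood' v hv).1 (hGood v hv).1
      hη hηs hηK f' (hy v hv) h𝓕 h𝓕c hψ (hGood v hv).2.1 (hGood v hv).2.2
  let ϖ : ∀ v : HeightOneSpectrum (𝓞 K), (v.adicCompletion K)ˣ := fun v =>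
    if hv : v ∉ S' then Classical.choose (hex v hv) else 1
  have hW : ∀ v ∉ S', IsTorusUnramifiedAt n K W v (ϖ v) (x v) := fun v hv => by
    simp only [ϖ, dif_pos hv]
    exact Classical.choose_spec (hex v hv)
  have hW' : ∀ v ∉ S', IsTorusUnramifiedAt n K (star W') v (ϖ v) (star (y v)) := fun v hv => by
    obtain ⟨ϖ', hϖ'⟩ := hex' v hv
    exact (hϖ'.of_valued_eq (hW v hv).valued_eq).star
  -- central invariance of `‖W‖`
  obtain ⟨ω, hu, -, -, -, -, hcl⟩ := P.exists_centralCharacter_smoothedForm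
  have hWZ : ∀ (z : ideleGroup K) (g : GL (Fin n) (AdeleRing (𝓞 K) K)),
      ‖W (Matrix.GeneralLinearGroup.scalar (Fin n) z * g)‖ = ‖W g‖ := fun z g => by
    rw [hWdef, whittakerCoeff_scalar_mul (fun g' => hcl η f z g') g, norm_mul, hu z, one_mul]
  -- the test function
  have hΦ0 : ∀ y, 0 ≤ Φ y := standardTestFun_nonneg hΦinf
  have hΦv : ∀ v ∉ S', ∀ y : Fin n → AdeleRing (𝓞 K) K, Φ y ≠ 0 → ∀ j, Valued.v ((y j).2 v) ≤ 1 :=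
    fun v _ y hy j => standardTestFun_ne_zero_valued_le_one Φinf hy j
  -- integrability of the complex pair integrand
  have hWc : Continuous W := continuous_whittakerCoeff h𝓕m h𝓕c hψ.continuous
    (continuous_invQuot_smoothedForm hη hηs _)
  have hW'c : Continuous W' := continuous_whittakerCoeff h𝓕m h𝓕c hψ.continuous
    (continuous_invQuot_smoothedForm hη hηs _)
  have hW'sc : Continuous (star W') := hW'c.star
  haveI : SecondCountableTopology (GL (Fin n) (AdeleRing (𝓞 K) K)) :=
    secondCountableTopology_generalLinearGroup_adeleRing K (Fin n)
  haveI : SecondCountableTopology (AdelicGroupData.gl n K).Adelic :=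
    secondCountableTopology_generalLinearGroup_adeleRing K (Fin n)
  haveI : SecondCountableTopology ↥(maximalCompactAdelic n K) := TopologicalSpace.Subtype.secondCountableTopology _
  have hpt : Measurable (torusPoint n K) := continuous_torusPoint.measurable
  have hmeas : Measurable (torusPairIntegrandC n K W (star W') Φ s) :=
    measurable_torusPairIntegrandC (hWc.measurable.comp hpt) (hW'sc.measurable.comp hpt) (hΦm.comp hpt) s
  have hfin'' : rankinSelbergTorusIntegral n K νA νK (star W') Φ s.re ≠ ⊤ := by
    rw [rankinSelbergTorusIntegral_star]; exact hfin'
  have hint : Integrable (torusPairIntegrandC n K W (star W') Φ s) (νA.prod νK) :=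
    integrable_torusPairIntegrandC νA νK hΦ0 hmeas.aestronglyMeasurable (measurable_torusIntegrand hWc hΦm s.re)
      (measurable_torusIntegrand hW'sc hΦm s.re) hfin hfin''
  -- finiteness of the real torus sums at `re s` from the Satake bound
  have hy' : ∀ v ∉ S', (Finset.univ : Finset (Fin n)).val.map (star (y v)) = (γ v).map conj := fun v hv => by
    rw [← hy v hv, Multiset.map_map]
    rfl
  have hTx : ∀ v ∉ S', schurSelfSum (x v) ((v.residueCard : ℝ) ^ (-s.re)) ≠ ⊤ := fun v hv =>
    schurSelfSum_ne_top_of_norm_satakeParameter_le_sqrt norm_satakeParameter_le_sqrt_holds P hα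
      (hGood' v hv).1 (x v) (hx v hv) hs
  have hTy : ∀ v ∉ S', schurSelfSum (star (y v)) ((v.residueCard : ℝ) ^ (-s.re)) ≠ ⊤ := fun v hv =>
    schurSelfSum_ne_top_of_norm_satakeParameter_le_sqrt norm_satakeParameter_le_sqrt_holds Q.conj hγ.conj
      (hGood' v hv).1 (star (y v)) (hy' v hv) hs
  -- the Euler product of the local factors
  have hL := hasProd_partialPairL JacquetShalika1981_multipliable_partialPairL_holds P Q.conj (hα.mono hSS')
    (hγ.mono hSS').conj hs
  exact rankinSelbergTorusPairIntegralC_eq_mul_setIntegral_of_hasProd νA νK hn hW hW' hWZ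
    (fun v _ => isLastRowSphericalAt_standardTestFun Φinf v) hΦv hΦ0 hint hTx hTy hx hy' hL

end Cuspidal

end Literature.NumberTheory.Automorphic
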